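import Literature.NumberTheory.Weil1964.LocalBinaryGaussIntegral
import Literature.NumberTheory.QuadraticForms.HilbertSymbol
import HarnessLib

/-!
# The Weil index of `b (x² - a y²)` depends on `b` only modulo norms from `F(√a)`

Topic `NumberTheory/Weil1964`; namespace `Literature.NumberTheory.Weil1964`. KERNEL mathematics only
(plumbing definitions with bodies + theorems; no named fact, no `axiom`, no `sorry`). Sequel of
`LocalBinaryGaussIntegral.lean`.

Weil ([Weil1964], Chap. II n° 28, pp. 175–177) proves `γ(n) = -1` for the norm form `n` of the quaternion
division algebra `𝔎` over the local field `k` (Prop. 4) by the substitution `z ↦ c z` in `g(n, M) = ∫_M χ(n(z)) dz`,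
whose module is `|n(c)|²`, and integration along the fibres of `n`; with Prop. 3 this yields
`γ(x² - a y² - b z² + a b t²) = (a, b)` (p. 176) and the Hilbert-symbol law (28). This file transplants the
SUBSTITUTION STEP from the quaternion algebra to the quadratic algebra `E = F(√a) ≅ F × F`: multiplication by
`s + √a` is the linear map

  `T_{a,s}(x, y) = (s x + a y, x + s y)`   (`normMul a s`),   `N(T z) = (s² - a) N(z)`,  `N(x, y) = x² - a y²`,

its module for the Haar measure `μ × μ` of `F × F` is `‖s² - a‖` (`map_normMul`: decomposition into two shears
`(x, y) ↦ (x + s y, y)` and one coordinate dilation, so no general `‖det‖` theory is needed), and consequently,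
for `c = s² - a = N(s + √a) ≠ 0` and the binary form `b N = b x² ⊕ (-ab) y²`,

  `g(bc) g(-abc) = ‖c‖⁻¹ · g(b) g(-ab)`   (`weilGauss_mul_weilGauss_normClass`, the lattice-independence of
  `LocalBinaryGaussIntegral.lean` applied to the skew lattice `T(𝔭^m × 𝔭^m)`), hence

  `γ(bc) γ(-abc) = γ(b) γ(-ab)`   (`weilIndex_mul_weilIndex_normClass`):

the index of `b · N_{E/F}` only depends on `b` modulo the norms `s² - a` — the `(a, c) = 1` half of Weil's
`γ(x² - ay² - bz² + abt²) = (a, b)`. Since `γ(b t²) = γ(b)` and every norm is `t²` or `t² (s² - a)`, this gives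
(§4, with O'Meara's `(a, b)_F = 1 ⟺ b ∈ N(F(√a)ˣ)`, tree `QuadraticForms.hilbertSymbol`):

  `(a, b)_F = 1  ⟹  γ(b) γ(-ab) = γ(1) γ(-a)`   (`weilIndex_mul_weilIndex_eq_of_hilbertSymbol_eq_one`).

Nothing here requires `a` to be a non-square.

NOT here: the other half (`γ` changes sign on the non-trivial norm class), which needs Weil's integration
along the fibres of `N` and `[Fˣ : N(Eˣ)] = 2`; with it, (28) `γ(a)γ(b) = γ(1)γ(ab)(a,b)` and `γ⁸ = 1` follow.

## References

* [Weil1964] A. Weil, *Sur certains groupes d'opérateurs unitaires*, Acta Math. 111 (1964) 143–211, Chap. II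
  n° 27 (pp. 174–175), n° 28 Prop. 4 and its proof (pp. 175–176), (28) (p. 177).
-/

set_option autoImplicit false

noncomputable section

open MeasureTheory ValuativeRel Filter Topology Set
open scoped NNReal ENNReal Pointwise
open Literature.NumberTheory.GaloisRepresentations.IsNonarchimedeanLocalField
open Literature.NumberTheory.Automorphic

namespace Literature.NumberTheory.Weil1964

variable {F : Type*} [Field F] [ValuativeRel F] [TopologicalSpace F] [IsNonarchimedeanLocalField F]

/-! ## §1 Multiplication by `s + √a` on `F × F` -/

section NormMul

/-- **multiplication by `s + √a`** on `E = F ⊕ F√a ≅ F × F`: `(x, y) ↦ (s x + a y, x + s y)` (Weil's substitution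
`z ↦ c z`, here in the quadratic algebra). [cite: Weil1964, Chap. II n° 28, p. 176] -/
def normMul (a s : F) (z : F × F) : F × F := (s * z.1 + a * z.2, z.1 + s * z.2)

omit [ValuativeRel F] [TopologicalSpace F] [IsNonarchimedeanLocalField F] in
/-- unfolding. [cite: Weil1964, Chap. II n° 28, p. 176] -/
theorem normMul_apply (a s : F) (z : F × F) : normMul a s z = (s * z.1 + a * z.2, z.1 + s * z.2) := rfl

omit [ValuativeRel F] [TopologicalSpace F] [IsNonarchimedeanLocalField F] in
/-- **`N(T z) = N(s + √a) N(z)`**: `(s x + a y)² - a (x + s y)² = (s² - a)(x² - a y²)` (multiplicativity of the norm).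
[cite: Weil1964, Chap. II n° 28, p. 176] -/
theorem norm_normMul (a s : F) (z : F × F) :
    (normMul a s z).1 ^ 2 - a * (normMul a s z).2 ^ 2 = (s ^ 2 - a) * (z.1 ^ 2 - a * z.2 ^ 2) := by
  simp only [normMul]
  ring

omit [ValuativeRel F] [TopologicalSpace F] [IsNonarchimedeanLocalField F] in
/-- `T` is additive. [cite: Weil1964, Chap. II n° 28, p. 176] -/
theorem normMul_add (a s : F) (z w : F × F) : normMul a s (z + w) = normMul a s z + normMul a s w := by
  simp only [normMul, Prod.fst_add, Prod.snd_add, Prod.mk_add_mk]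
  ext <;> ring

omit [ValuativeRel F] [IsNonarchimedeanLocalField F] in
/-- `T` is continuous. [cite: Weil1964, Chap. II n° 28, p. 176] -/
theorem continuous_normMul [IsTopologicalRing F] (a s : F) : Continuous (normMul a s) :=
  ((continuous_const.mul continuous_fst).add (continuous_const.mul continuous_snd)).prodMk
    (continuous_fst.add (continuous_const.mul continuous_snd))

/-- `T` as a measurable equivalence of `F × F` (inverse `c⁻¹ (s x - a y, -x + s y)`, `c = s² - a ≠ 0`).
[cite: Weil1964, Chap. II n° 28, p. 176] -/
def normMulEquiv [MeasurableSpace F] [BorelSpace F] (a s : F) (hc : s ^ 2 - a ≠ 0) : F × F ≃ᵐ F × F where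
  toFun := normMul a s
  invFun w := ((s ^ 2 - a)⁻¹ * (s * w.1 - a * w.2), (s ^ 2 - a)⁻¹ * (-w.1 + s * w.2))
  left_inv z := by
    simp only [normMul]
    ext
    · field_simp
      ring
    · field_simp
      ring
  right_inv w := by
    simp only [normMul]
    ext
    · field_simp
      ring
    · field_simp
      ring
  measurable_toFun := by
    haveI : SecondCountableTopology F := secondCountableTopology_localField F
    exact (continuous_normMul a s).measurable
  measurable_invFun := by
    haveI : SecondCountableTopology F := secondCountableTopology_localField F
    exact (((continuous_const.mul continuous_fst).sub (continuous_const.mul continuous_snd)).const_mul _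
      |>.prodMk ((continuous_fst.neg.add (continuous_const.mul continuous_snd)).const_mul _)).measurable

/-- the underlying function of `normMulEquiv`. [cite: Weil1964, Chap. II n° 28, p. 176] -/
theorem coe_normMulEquiv [MeasurableSpace F] [BorelSpace F] (a s : F) (hc : s ^ 2 - a ≠ 0) :
    ⇑(normMulEquiv a s hc) = normMul a s := rfl

end NormMul

/-! ## §2 The module of `T` is `‖s² - a‖` -/

section Module

/-- `F` is second countable (instance helper). [folklore] -/
private theorem secondCountable' : SecondCountableTopology F := secondCountableTopology_localField F

variable [MeasurableSpace F] [BorelSpace F] (μ : Measure F) [μ.IsAddHaarMeasure]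

omit [BorelSpace F] in
/-- a Haar measure on `F` is `σ`-finite (instance helper). [folklore] -/
private theorem sigmaFinite_haar' : SigmaFinite μ := by
  haveI : T2Space F :=
    (Literature.NumberTheory.GaloisRepresentations.IsNonarchimedeanLocalField.isLocalField F).toT2Space
  haveI : LocallyCompactSpace F :=
    (Literature.NumberTheory.GaloisRepresentations.IsNonarchimedeanLocalField.isLocalField F).toLocallyCompactSpace
  haveI : SecondCountableTopology F := secondCountable'
  infer_instance

/-- the shear `(x, y) ↦ (x + s y, y)` preserves `μ × μ` (translation invariance in the first variable, fibrewise).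
[folklore] -/
private theorem measurePreserving_shear (s : F) :
    MeasurePreserving (fun z : F × F => (z.1 + s * z.2, z.2)) (μ.prod μ) (μ.prod μ) := by
  haveI : SecondCountableTopology F := secondCountable'
  haveI := sigmaFinite_haar' μ
  have h1 : MeasurePreserving (fun p : F × F => (p.1, p.2 + s * p.1)) (μ.prod μ) (μ.prod μ) :=
    (MeasurePreserving.id μ).skew_product (g := fun y x => x + s * y)
      (measurable_snd.add (measurable_const.mul measurable_fst))
      (Eventually.of_forall fun y => map_add_right_eq_self μ (s * y))
  have e : (fun z : F × F => (z.1 + s * z.2, z.2)) =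
      Prod.swap ∘ (fun p : F × F => (p.1, p.2 + s * p.1)) ∘ Prod.swap := by
    funext z; rfl
  have hsw : MeasurePreserving (Prod.swap : F × F → F × F) (μ.prod μ) (μ.prod μ) :=
    Measure.measurePreserving_swap
  rw [e]
  exact (hsw.comp h1).comp hsw

/-- the map `(x, y) ↦ (c' y, x)` multiplies `μ × μ` by `‖c'‖⁻¹` (one coordinate dilated). [folklore] -/
private theorem map_scaleSwap {c' : F} (hc' : c' ≠ 0) :
    Measure.map (fun z : F × F => (c' * z.2, z.1)) (μ.prod μ) =
      ((normAbs F c'⁻¹ : ℝ≥0) : ℝ≥0∞) • μ.prod μ := by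
  haveI : SecondCountableTopology F := secondCountable'
  haveI := sigmaFinite_haar' μ
  have e : (fun z : F × F => (c' * z.2, z.1)) = Prod.map (fun x => c' * x) id ∘ Prod.swap := by
    funext z; rfl
  have hsw : MeasurePreserving (Prod.swap : F × F → F × F) (μ.prod μ) (μ.prod μ) :=
    Measure.measurePreserving_swap
  rw [e, ← Measure.map_map ((measurable_const_mul c').prodMap measurable_id) measurable_swap, hsw.map_eq,
    ← Measure.map_prod_map μ μ (measurable_const_mul c') measurable_id, map_mul_left_addHaar μ hc', Measure.map_id,
    Measure.prod_smul_left]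

/-- **the module of multiplication by `s + √a` is `‖N(s + √a)‖ = ‖s² - a‖`**: the image of `μ × μ` under `T` is
`‖s² - a‖⁻¹ · (μ × μ)` (`T` = shear ∘ (dilation ∘ swap) ∘ shear). [cite: Weil1964, Chap. II n° 28, p. 176] -/
theorem map_normMul (a s : F) (hc : s ^ 2 - a ≠ 0) :
    Measure.map (normMul a s) (μ.prod μ) = ((normAbs F (s ^ 2 - a)⁻¹ : ℝ≥0) : ℝ≥0∞) • μ.prod μ := by
  haveI : SecondCountableTopology F := secondCountable'
  haveI := sigmaFinite_haar' μ
  have hc' : a - s ^ 2 ≠ 0 := fun h => hc (by rw [← neg_sub, h, neg_zero])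
  have e : normMul a s = (fun z : F × F => (z.1 + s * z.2, z.2)) ∘ (fun z : F × F => ((a - s ^ 2) * z.2, z.1)) ∘
      (fun z : F × F => (z.1 + s * z.2, z.2)) := by
    funext z
    simp only [normMul, Function.comp_apply]
    ext <;> ring
  have hsh : Measurable (fun z : F × F => (z.1 + s * z.2, z.2)) :=
    (measurable_fst.add (measurable_const.mul measurable_snd)).prodMk measurable_snd
  have hsc : Measurable (fun z : F × F => ((a - s ^ 2) * z.2, z.1)) :=
    (measurable_const.mul measurable_snd).prodMk measurable_fst
  rw [e, ← Measure.map_map hsh (hsc.comp hsh), ← Measure.map_map hsc hsh, (measurePreserving_shear μ s).map_eq,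
    map_scaleSwap μ hc', Measure.map_smul, (measurePreserving_shear μ s).map_eq,
    show (a - s ^ 2)⁻¹ = -(s ^ 2 - a)⁻¹ by rw [← neg_sub, neg_inv], normAbs_neg]

/-- **substitution rule** `∫ Φ(T z) dz = ‖s² - a‖⁻¹ ∫ Φ(z) dz` on `F × F`.
[cite: Weil1964, Chap. II n° 28, p. 176] -/
theorem integral_comp_normMul (a s : F) (hc : s ^ 2 - a ≠ 0) (Φ : F × F → ℂ) :
    ∫ z, Φ (normMul a s z) ∂(μ.prod μ) =
      ((normAbs F (s ^ 2 - a)⁻¹ : ℝ≥0) : ℝ) • ∫ z, Φ z ∂(μ.prod μ) := by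
  rw [← coe_normMulEquiv a s hc, ← (normMulEquiv a s hc).measurableEmbedding.integral_map, coe_normMulEquiv,
    map_normMul μ a s hc, integral_smul_measure, ENNReal.coe_toReal]

end Module

/-! ## §3 Norm-class invariance of the index of `b (x² - a y²)` -/

section NormClass

variable [MeasurableSpace F] [BorelSpace F] (μ : Measure F) [μ.IsAddHaarMeasure] {ψ : AddChar F Circle}

omit [ValuativeRel F] [TopologicalSpace F] [IsNonarchimedeanLocalField F] [MeasurableSpace F] [BorelSpace F]
  [μ.IsAddHaarMeasure] in
/-- `ψ(b c x² - a b c y²) = ψ(b (Tz)₁² - a b (Tz)₂²)`: the form `b N` pulled back by `T` is `(b c) N`.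
[cite: Weil1964, Chap. II n° 28, p. 176] -/
theorem psiSq₂_normMul (ψ : AddChar F Circle) (a s b : F) (z : F × F) :
    psiSq₂ ψ b (-(a * b)) (normMul a s z) = psiSq₂ ψ (b * (s ^ 2 - a)) (-(a * (b * (s ^ 2 - a)))) z := by
  rw [psiSq₂_apply, psiSq₂_apply]
  congr 2
  have h := norm_normMul a s z
  linear_combination b * h

/-- the skew lattice `T(𝔭^m × 𝔭^m)` contains the box `𝔭^{m₀} × 𝔭^{m₀}` as soon as `m ≤ k + m₀`, where
`c⁻¹ s, c⁻¹ a, c⁻¹ ∈ 𝔭^k` (`c = s² - a`). [cite: Weil1964, Chap. II n° 27, p. 174] -/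
theorem primePowBox_subset_image_normMul {a s : F} (hc : s ^ 2 - a ≠ 0) {k : ℤ}
    (hks : (s ^ 2 - a)⁻¹ * s ∈ primePowBall F k) (hka : (s ^ 2 - a)⁻¹ * a ∈ primePowBall F k)
    (hk1 : (s ^ 2 - a)⁻¹ ∈ primePowBall F k) {m m₀ : ℤ} (hm : m ≤ k + m₀) :
    primePowBox F m₀ ⊆ normMul a s '' primePowBox F m := by
  intro w hw
  rw [mem_primePowBox_iff] at hw
  refine ⟨(normMulEquiv a s hc).symm w, ?_, (normMulEquiv a s hc).apply_symm_apply w⟩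
  show ((s ^ 2 - a)⁻¹ * (s * w.1 - a * w.2), (s ^ 2 - a)⁻¹ * (-w.1 + s * w.2)) ∈ primePowBox F m
  rw [mem_primePowBox_iff]
  constructor
  · have h1 := mul_mem_primePowBall hks hw.1
    have h2 := mul_mem_primePowBall hka hw.2
    rw [show (s ^ 2 - a)⁻¹ * (s * w.1 - a * w.2) = (s ^ 2 - a)⁻¹ * s * w.1 + -((s ^ 2 - a)⁻¹ * a * w.2) by ring]
    exact primePowBall_antitone hm (add_mem_primePowBall h1 (neg_mem_primePowBall h2))
  · have h1 := mul_mem_primePowBall hk1 hw.1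
    have h2 := mul_mem_primePowBall hks hw.2
    rw [show (s ^ 2 - a)⁻¹ * (-w.1 + s * w.2) = -((s ^ 2 - a)⁻¹ * w.1) + (s ^ 2 - a)⁻¹ * s * w.2 by ring]
    exact primePowBall_antitone hm (add_mem_primePowBall (neg_mem_primePowBall h1) h2)

omit [MeasurableSpace F] [BorelSpace F] in
/-- such a `k` exists. [cite: Weil1964, Chap. II n° 27, p. 174] -/
theorem exists_inv_mul_mem_primePowBall (a s : F) :
    ∃ k : ℤ, (s ^ 2 - a)⁻¹ * s ∈ primePowBall F k ∧ (s ^ 2 - a)⁻¹ * a ∈ primePowBall F k ∧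
      (s ^ 2 - a)⁻¹ ∈ primePowBall F k := by
  obtain ⟨k₁, h₁⟩ := exists_mem_primePowBall ((s ^ 2 - a)⁻¹ * s)
  obtain ⟨k₂, h₂⟩ := exists_mem_primePowBall ((s ^ 2 - a)⁻¹ * a)
  obtain ⟨k₃, h₃⟩ := exists_mem_primePowBall ((s ^ 2 - a)⁻¹ : F)
  exact ⟨min k₁ (min k₂ k₃), primePowBall_antitone (min_le_left _ _) h₁,
    primePowBall_antitone ((min_le_right _ _).trans (min_le_left _ _)) h₂,
    primePowBall_antitone ((min_le_right _ _).trans (min_le_right _ _)) h₃⟩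

/-- **the transfer identity** `g(bc) · g(-abc) = ‖c‖⁻¹ · g(b) · g(-ab)` for `c = s² - a = N(s + √a) ≠ 0`
(`g` = Weil's stable Gauss integral; proof: `g(bc)g(-abc) = ∫_{𝔭^m×𝔭^m} ψ(bc·N) = ∫_{𝔭^m×𝔭^m} ψ(b N ∘ T)
= ‖c‖⁻¹ ∫_{T(𝔭^m×𝔭^m)} ψ(b N) = ‖c‖⁻¹ g(b) g(-ab)` by lattice independence).
[cite: Weil1964, Chap. II n° 28, pp. 175–176] -/
theorem weilGauss_mul_weilGauss_normClass (hψ : ψ.IsContinuousNontrivial) {a b s : F} (ha : a ≠ 0) (hb : b ≠ 0)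
    (hc : s ^ 2 - a ≠ 0) (htwo : (2 : F) ≠ 0) :
    weilGauss ψ μ (b * (s ^ 2 - a)) * weilGauss ψ μ (-(a * (b * (s ^ 2 - a)))) =
      (((normAbs F (s ^ 2 - a))⁻¹ : ℝ≥0) : ℂ) * (weilGauss ψ μ b * weilGauss ψ μ (-(a * b))) := by
  haveI : SecondCountableTopology F := secondCountable'
  set c : F := s ^ 2 - a with hcdef
  have hab : -(a * b) ≠ 0 := neg_ne_zero.2 (mul_ne_zero ha hb)
  have hbc : b * c ≠ 0 := mul_ne_zero hb hc
  have habc : -(a * (b * c)) ≠ 0 := neg_ne_zero.2 (mul_ne_zero ha hbc)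
  -- lattice independence for the two parameter pairs
  obtain ⟨ℓ, m₀, hmℓ, hD⟩ := exists_forall_gaussBox_eq_weilGauss_mul μ hψ hb hab htwo
  obtain ⟨ℓ', m₀', hmℓ', hD'⟩ := exists_forall_gaussBox_eq_weilGauss_mul μ hψ hbc habc htwo
  obtain ⟨k, hks, hka, hk1⟩ := exists_inv_mul_mem_primePowBall a s
  set m : ℤ := min (k + m₀) m₀' with hmdef
  -- the box `𝔭^m × 𝔭^m` for the parameters `(bc, -abc)`
  have hbox : gaussBox ψ μ (b * c) (-(a * (b * c))) (primePowBox F m) =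
      weilGauss ψ μ (b * c) * weilGauss ψ μ (-(a * (b * c))) :=
    hD' _ (isCompact_primePowBox m)
      (fun x hx h hh => add_mem_primePowBox hx (primePowBox_antitone (by omega) hh))
      (primePowBox_antitone (min_le_right _ _))
  -- the skew lattice `D = T(𝔭^m × 𝔭^m)` for the parameters `(b, -ab)`
  set D : Set (F × F) := normMul a s '' primePowBox F m with hDdef
  have hDm₀ : primePowBox F m₀ ⊆ D := primePowBox_subset_image_normMul hc hks hka hk1 (min_le_left _ _)
  have hDadd : ∀ x ∈ D, ∀ y ∈ D, x + y ∈ D := by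
    rintro _ ⟨u, hu, rfl⟩ _ ⟨u', hu', rfl⟩
    exact ⟨u + u', add_mem_primePowBox hu hu', normMul_add a s u u'⟩
  have hskew : gaussBox ψ μ b (-(a * b)) D = weilGauss ψ μ b * weilGauss ψ μ (-(a * b)) :=
    hD D ((isCompact_primePowBox m).image (continuous_normMul a s))
      (fun x hx h hh => hDadd x hx h (hDm₀ (primePowBox_antitone hmℓ hh))) hDm₀
  -- the substitution
  have hinj : Function.Injective (normMul a s) := (normMulEquiv a s hc).injective
  have hsub : gaussBox ψ μ (b * c) (-(a * (b * c))) (primePowBox F m) =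
      (((normAbs F c)⁻¹ : ℝ≥0) : ℂ) * gaussBox ψ μ b (-(a * b)) D := by
    haveI := sigmaFinite_haar' μ
    haveI : T2Space F :=
      (Literature.NumberTheory.GaloisRepresentations.IsNonarchimedeanLocalField.isLocalField F).toT2Space
    have hDmeas : MeasurableSet D :=
      ((isCompact_primePowBox m).image (continuous_normMul a s)).measurableSet
    rw [gaussBox_def, gaussBox_def, ← integral_indicator
        ((isCompact_primePowBox m).measurableSet), ← integral_indicator hDmeas]
    have e : (fun z => (primePowBox F m).indicator (psiSq₂ ψ (b * c) (-(a * (b * c)))) z) =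
        fun z => D.indicator (psiSq₂ ψ b (-(a * b))) (normMul a s z) := by
      funext z
      by_cases hz : z ∈ primePowBox F m
      · rw [Set.indicator_of_mem hz, Set.indicator_of_mem (show normMul a s z ∈ D from Set.mem_image_of_mem _ hz),
          psiSq₂_normMul]
      · have hz' : normMul a s z ∉ D := fun ⟨u, hu, huz⟩ => hz (hinj huz ▸ hu)
        rw [Set.indicator_of_notMem hz, Set.indicator_of_notMem hz']
    rw [e, integral_comp_normMul μ a s hc, map_inv₀, Complex.real_smul, NNReal.coe_inv, Complex.ofReal_inv]
  rw [← hbox, hsub, hskew]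

/-- phases of complex numbers differing by a positive real factor coincide. [folklore] -/
private theorem div_norm_eq_of_eq_mul {z w : ℂ} {r : ℝ} (hr : 0 < r) (h : z = (r : ℂ) * w) :
    z / (‖z‖ : ℂ) = w / (‖w‖ : ℂ) := by
  have hr' : ((r : ℝ) : ℂ) ≠ 0 := Complex.ofReal_ne_zero.2 hr.ne'
  rw [h, norm_mul, Complex.norm_real, Real.norm_of_nonneg hr.le, Complex.ofReal_mul, mul_div_mul_left _ _ hr']

omit [BorelSpace F] [μ.IsAddHaarMeasure] in
/-- `γ(x) γ(y) = g(x)g(y) / |g(x)g(y)|`. [cite: Weil1964, Chap. II n° 27, p. 175] -/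
theorem weilIndex_mul_weilIndex (ψ : AddChar F Circle) (x y : F) :
    weilIndex ψ μ x * weilIndex ψ μ y =
      (weilGauss ψ μ x * weilGauss ψ μ y) / (‖weilGauss ψ μ x * weilGauss ψ μ y‖ : ℂ) := by
  rw [weilIndex_def, weilIndex_def, norm_mul, Complex.ofReal_mul, div_mul_div_comm]

/-- **NORM-CLASS INVARIANCE** `γ(bc) γ(-abc) = γ(b) γ(-ab)` for `c = s² - a = N_{F(√a)/F}(s + √a) ≠ 0`: the Weil
index of the binary form `b · N_{F(√a)/F}` depends on `b` only through its class modulo norms — the `(a, c) = 1`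
half of Weil's `γ(x² - ay² - bz² + abt²) = (a, b)`, by Weil's substitution device for Prop. 4 run in `F(√a)`.
[cite: Weil1964, Chap. II n° 28, pp. 175–177] -/
theorem weilIndex_mul_weilIndex_normClass (hψ : ψ.IsContinuousNontrivial) {a b s : F} (ha : a ≠ 0) (hb : b ≠ 0)
    (hc : s ^ 2 - a ≠ 0) (htwo : (2 : F) ≠ 0) :
    weilIndex ψ μ (b * (s ^ 2 - a)) * weilIndex ψ μ (-(a * (b * (s ^ 2 - a)))) =
      weilIndex ψ μ b * weilIndex ψ μ (-(a * b)) := by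
  rw [weilIndex_mul_weilIndex, weilIndex_mul_weilIndex]
  have hr : (0 : ℝ) < ((normAbs F (s ^ 2 - a))⁻¹ : ℝ≥0) := by
    have h0 : 0 < normAbs F (s ^ 2 - a) := pos_iff_ne_zero.2 fun h => hc ((map_eq_zero (normAbs F)).1 h)
    exact_mod_cast inv_pos.2 h0
  exact div_norm_eq_of_eq_mul hr (weilGauss_mul_weilGauss_normClass μ hψ ha hb hc htwo)

end NormClass

/-! ## §4 The `(a, b) = 1` half of the Hilbert-symbol law -/

section HilbertOne

variable [MeasurableSpace F] [BorelSpace F] (μ : Measure F) [μ.IsAddHaarMeasure] {ψ : AddChar F Circle}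

/-- squares do not change `γ(b) γ(-ab)`: `γ(t²) γ(-a t²) = γ(1) γ(-a)`. [cite: Weil1964, Chap. II n° 25, p. 173] -/
theorem weilIndex_sq_mul_weilIndex_neg_mul_sq (hψ : ψ.IsContinuousNontrivial) {a t : F} (ha : a ≠ 0) (ht : t ≠ 0)
    (htwo : (2 : F) ≠ 0) :
    weilIndex ψ μ (t ^ 2) * weilIndex ψ μ (-(a * t ^ 2)) = weilIndex ψ μ 1 * weilIndex ψ μ (-a) := by
  rw [show t ^ 2 = 1 * t ^ 2 by ring, show -(a * (1 * t ^ 2)) = -a * t ^ 2 by ring,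
    weilIndex_mul_sq μ hψ one_ne_zero htwo ht, weilIndex_mul_sq μ hψ (neg_ne_zero.2 ha) htwo ht]

/-- norms do not change `γ(b) γ(-ab)`: `γ(t²(s² - a)) γ(-a t²(s² - a)) = γ(1) γ(-a)`.
[cite: Weil1964, Chap. II n° 28, pp. 175–177] -/
theorem weilIndex_norm_mul_weilIndex_neg_mul_norm (hψ : ψ.IsContinuousNontrivial) {a s t : F} (ha : a ≠ 0)
    (hc : s ^ 2 - a ≠ 0) (ht : t ≠ 0) (htwo : (2 : F) ≠ 0) :
    weilIndex ψ μ (t ^ 2 * (s ^ 2 - a)) * weilIndex ψ μ (-(a * (t ^ 2 * (s ^ 2 - a)))) =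
      weilIndex ψ μ 1 * weilIndex ψ μ (-a) := by
  rw [show t ^ 2 * (s ^ 2 - a) = (1 * (s ^ 2 - a)) * t ^ 2 by ring,
    show -(a * ((1 * (s ^ 2 - a)) * t ^ 2)) = -(a * (1 * (s ^ 2 - a))) * t ^ 2 by ring,
    weilIndex_mul_sq μ hψ (by simpa using hc) htwo ht,
    weilIndex_mul_sq μ hψ (neg_ne_zero.2 (mul_ne_zero ha (by simpa using hc))) htwo ht,
    weilIndex_mul_weilIndex_normClass μ hψ ha one_ne_zero hc htwo, mul_one]

/-- **`(a, b)_F = 1 ⟹ γ(b) γ(-ab) = γ(1) γ(-a)`** — the half of the Hilbert-symbol law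
`γ(a)γ(b) = γ(1)γ(ab)(a,b)` ([Weil1964] (28) and p. 176) in which `b` is a norm from `F(√a)`: from
`a x² + b y² = 1` (O'Meara's definition of `(a, b) = 1`, tree `hilbertSymbol`) `b` is `t²` or `t² (s² - a)`.
[cite: Weil1964, Chap. II n° 28, pp. 176–177] -/
theorem weilIndex_mul_weilIndex_eq_of_hilbertSymbol_eq_one (hψ : ψ.IsContinuousNontrivial) {a b : F}
    (ha : a ≠ 0) (hb : b ≠ 0) (htwo : (2 : F) ≠ 0) (h : QuadraticForms.hilbertSymbol F a b = 1) :
    weilIndex ψ μ b * weilIndex ψ μ (-(a * b)) = weilIndex ψ μ 1 * weilIndex ψ μ (-a) := by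
  obtain ⟨x, y, hxy⟩ := (QuadraticForms.hilbertSymbol_eq_one_iff a b).1 h
  by_cases hy : y = 0
  · -- `a = x⁻²` is a square: `b = X² - a Y²` with `X = (b+1)/2`, `Y = x(1-b)/2`
    subst hy
    have hax : a * x ^ 2 = 1 := by linear_combination hxy
    have hx : x ≠ 0 := by rintro rfl; simp at hax
    set X : F := (b + 1) / 2 with hX
    set Y : F := x * (1 - b) / 2 with hY
    have hbXY : b = X ^ 2 - a * Y ^ 2 := by
      rw [hX, hY]; field_simp; linear_combination ((1 - b) ^ 2) * hax
    by_cases hY0 : Y = 0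
    · have hbX : b = X ^ 2 := by rw [hbXY, hY0]; ring
      have hX0 : X ≠ 0 := by rintro h0; exact hb (by rw [hbX, h0]; ring)
      rw [hbX]
      exact weilIndex_sq_mul_weilIndex_neg_mul_sq μ hψ ha hX0 htwo
    · have hbn : b = Y ^ 2 * ((X / Y) ^ 2 - a) := by rw [hbXY]; field_simp
      have hc : (X / Y) ^ 2 - a ≠ 0 := fun h0 => hb (by rw [hbn, h0, mul_zero])
      rw [hbn]
      exact weilIndex_norm_mul_weilIndex_neg_mul_norm μ hψ ha hc hY0 htwo
  · by_cases hx : x = 0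
    · subst hx
      have hby : b = (1 / y) ^ 2 := by field_simp; linear_combination hxy
      rw [hby]
      exact weilIndex_sq_mul_weilIndex_neg_mul_sq μ hψ ha (by simpa using hy) htwo
    · have hbn : b = (x / y) ^ 2 * ((1 / x) ^ 2 - a) := by field_simp; linear_combination hxy
      have hc : (1 / x) ^ 2 - a ≠ 0 := fun h0 => hb (by rw [hbn, h0, mul_zero])
      rw [hbn]
      exact weilIndex_norm_mul_weilIndex_neg_mul_norm μ hψ ha hc (div_ne_zero hx hy) htwo

end HilbertOne

end Literature.NumberTheory.Weil1964
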